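import Literature.NumberTheory.Rogawski1990.ArchPlaneHaarHSBallLocal     -- ★ p848650∕678 (T1)(T2e): `archPlaneLiftUnitary`, `coe_archPlaneLiftUnitary`, `archPlaneLiftGL`, `continuous_archPlaneLift_uncurry'`
import HarnessLib

/-!
# The split torus `T = G_γ` of `U(Φ₂)(ℂ) ≅ U(1,1)` at a split regular `γ = diag(z₀a, z₀b)`: diagonal entries, the real elements `d_τ = lift(z, diag(τ⁻¹, τ))`,
# and the `χ`-shell `{t ∣ |t₁₁|² ∈ [s, 2s]}` — its torus mass is independent of `s` (left invariance), positive and finite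
# (part 1 of head (ii) of DEAL #11 «(VOL-split-measure)», line LH3∕LH2 (VOL) kit; Beuzart-Plessis 2020 §1.2, §1.8)

Topic `NumberTheory/Rogawski1990`; namespace `Literature.NumberTheory.Rogawski1990`.  THEOREMS ONLY (no `def`, no instance, no notation, no axiom, no named fact,
no `sorry`).  Cell `pub/hodgecm-mathlib`, crux H413 (`stmt-HodgeConjecture-24833`), F0∕P3c line LH3 kit, DEAL #11 of LH3-plan (g0) (2026-09-02T03:24:33Z ∕ 03:28:17Z),
seat LH2-p04 (g2).  Consumed by ★ `ArchHyperbolicOrbitMeasure` (the head: quotient volume of split orbit HS-balls `≤ C√R`), where the weight `κ_T⁻¹ · 1_SLAB` needs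
exactly the three facts proved here about the torus measure `ρ`: the `χ`-shell mass `κ_T(s) = ρ{t ∣ |t₁₁|² ∈ [s, 2s]}` does not depend on `s > 0`
(`measure_chi_Icc_eq`), and `κ_T = κ_T(1)` is finite (`measure_chi_Icc_lt_top`, the shell is compact) and non-zero (`measure_chi_Icc_ne_zero`).

THE MATHEMATICS.  `G = U(Φ₂)(ℂ) ≤ GL₂(ℂ)` (`Φ₂ = antidiag(1,1)`, ★ `unitaryGroupOfForm (starRingEnd ℂ) Φ₂`), `γ = diag(z₀a, z₀b) ∈ G` with `z₀ ≠ 0`, `a ≠ b` real.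
* Every `t ∈ G_γ` is DIAGONAL (`apply_zero_one_eq_zero_of_mem_centralizer`, `apply_one_zero_eq_zero_of_mem_centralizer`: compare the off-diagonal entries of
  `tγ = γt`), hence `(t g)₁ⱼ = t₁₁ g₁ⱼ` (`mul_apply_one_of_mem_centralizer`) and `χ(t) = |t₁₁|²` is multiplicative (`normSq_apply_one_one_mul`), continuous.
* The real elements `d_τ(z) = lift(z, diag(τ⁻¹, τ)) = diag(z τ⁻¹, z τ)` (★ `archPlaneLiftUnitary` of (T1), `coe_lift_diag`) lie in `G_γ` (`lift_diag_mem_centralizer`),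
  `χ(d_τ(z)) = τ²`; conversely every `t ∈ G_γ` is `d_τ(z)` with `τ = |t₁₁|`, `z = t₁₁∕|t₁₁|` (`exists_eq_lift_diag_of_mem_centralizer`: `Φ₂`-unitarity of a diagonal
  matrix is `t̄₀₀ t₁₁ = 1`), and `(z, τ) ↦ d_τ(z)` is continuous on `S¹ × (0, ∞)` (`continuousOn_lift_diag`).
* Hence **`ρ{t ∣ χ(t) ∈ [s, 2s]} = ρ{t ∣ χ(t) ∈ [1, 2]}`** for every LEFT-INVARIANT `ρ` and `s > 0` (`{χ ∈ [1,2]} = d_{√s} · {χ ∈ [s,2s]}`-preimage,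
  `measure_chi_Icc_eq`) — no coordinates on `T`, no Haar uniqueness; the shell `{χ ∈ [1, 2]}` is COMPACT (closed, inside `d(S¹ × [1, √2])`, `isCompact_chi_Icc`), so of
  finite mass for `ρ` finite on compacts, and contains the open non-empty `{χ ∈ (1, 2)} ∋ d_{√(3∕2)}(1)`, so of positive mass for `ρ` positive on opens.
[BeuzartPlessis2020Asterisque, §1.2 (1.2.2), (1.2.4) p. 21; §1.8 p. 39: the torus normalisation behind the orbit estimates for split classes.]
ED. 2 (docstring-only): sub-locators re-pinned per lit4-(205)∕(210) L3-BP1∕L3-B2 (Beuzart-Plessis §1.8 p. 39, §1.2 (1.2.2)∕(1.2.4) p. 21; Borel §2.9); no statement or proof byte changed.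
HONEST LABEL: HC_CM is proved only modulo the 7 printed citations (2 remaining: hLiu418 = stmt-HodgeConjecture-24832, h413 = stmt-HodgeConjecture-24833) until rung 0
closes; this file closes no organ — kit under the LETTERS O1∕O3 (`stub_N9`) and O1″∕O3″ (`stub_N8`).

## References
* [BeuzartPlessis2020Asterisque] R. Beuzart-Plessis, *A local trace formula for the Gan–Gross–Prasad conjecture for unitary groups: the archimedean case*,
  Astérisque 418 (2020), §1.8 p. 39; §1.2 (1.2.2), (1.2.4) p. 21.
* [Borel1997] A. Borel, *Automorphic Forms on SL₂(ℝ)* (1997), §2.9 (Haar measures), §4.1 (1)–(3) (`SU(1,1)` model).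
-/

set_option autoImplicit false

noncomputable section

open Complex MeasureTheory Set Literature.MeasureTheory.Group Literature.NumberTheory.Automorphic Literature.NumberTheory.Automorphic.UnitaryGroup
open scoped Matrix ComplexConjugate NNReal ENNReal Real

namespace Literature.NumberTheory.Rogawski1990

/-! ## §1 The split torus `T = G_γ`: entries, the real elements `d_τ`, and the `s`-independence of `ρ{χ ∈ [s, 2s]}` -/

section Torus

variable {γ : ↥(unitaryGroupOfForm (starRingEnd ℂ) (Matrix.of fun i j : Fin 2 => if i.val + j.val + 1 = 2 then (1 : ℂ) else 0))} {z₀ : ℂ} {a b : ℝ}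

/-- For `γ = diag(z₀a, z₀b)` split regular (`z₀ ≠ 0`, `a ≠ b`), every element of the centraliser `G_γ` is DIAGONAL: `t₀₁ = 0`.
[cite: BeuzartPlessis2020Asterisque, §1.8 p. 39; §1.2 (1.2.2), (1.2.4) p. 21] -/
theorem apply_zero_one_eq_zero_of_mem_centralizer (hγ : (((γ : ↥(unitaryGroupOfForm (starRingEnd ℂ) (Matrix.of fun i j : Fin 2 => if i.val + j.val + 1 = 2 then (1 : ℂ) else 0))) : GL (Fin 2) ℂ) : Matrix (Fin 2) (Fin 2) ℂ) = !![z₀ * a, 0; 0, z₀ * b]) (hz₀ : z₀ ≠ 0) (hab : a ≠ b)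
    {t : ↥(unitaryGroupOfForm (starRingEnd ℂ) (Matrix.of fun i j : Fin 2 => if i.val + j.val + 1 = 2 then (1 : ℂ) else 0))} (ht : t ∈ Subgroup.centralizer ({γ} : Set ↥(unitaryGroupOfForm (starRingEnd ℂ) (Matrix.of fun i j : Fin 2 => if i.val + j.val + 1 = 2 then (1 : ℂ) else 0)))) : (((t : ↥(unitaryGroupOfForm (starRingEnd ℂ) (Matrix.of fun i j : Fin 2 => if i.val + j.val + 1 = 2 then (1 : ℂ) else 0))) : GL (Fin 2) ℂ) : Matrix (Fin 2) (Fin 2) ℂ) 0 1 = 0 := by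
  have h := Subgroup.mem_centralizer_singleton_iff.1 ht
  have hm : (((t : ↥(unitaryGroupOfForm (starRingEnd ℂ) (Matrix.of fun i j : Fin 2 => if i.val + j.val + 1 = 2 then (1 : ℂ) else 0))) : GL (Fin 2) ℂ) : Matrix (Fin 2) (Fin 2) ℂ) * (((γ : ↥(unitaryGroupOfForm (starRingEnd ℂ) (Matrix.of fun i j : Fin 2 => if i.val + j.val + 1 = 2 then (1 : ℂ) else 0))) : GL (Fin 2) ℂ) : Matrix (Fin 2) (Fin 2) ℂ) = (((γ : ↥(unitaryGroupOfForm (starRingEnd ℂ) (Matrix.of fun i j : Fin 2 => if i.val + j.val + 1 = 2 then (1 : ℂ) else 0))) : GL (Fin 2) ℂ) : Matrix (Fin 2) (Fin 2) ℂ) * (((t : ↥(unitaryGroupOfForm (starRingEnd ℂ) (Matrix.of fun i j : Fin 2 => if i.val + j.val + 1 = 2 then (1 : ℂ) else 0))) : GL (Fin 2) ℂ) : Matrix (Fin 2) (Fin 2) ℂ) := by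
    have := congrArg (fun u : ↥(unitaryGroupOfForm (starRingEnd ℂ) (Matrix.of fun i j : Fin 2 => if i.val + j.val + 1 = 2 then (1 : ℂ) else 0)) => ((u : GL (Fin 2) ℂ) : Matrix (Fin 2) (Fin 2) ℂ)) h
    simpa only [Subgroup.coe_mul, Units.val_mul] using this
  have h01 := congrFun (congrFun hm 0) 1
  simp only [hγ, Matrix.mul_apply, Fin.sum_univ_two, Matrix.of_apply, Matrix.cons_val', Matrix.cons_val_zero, Matrix.cons_val_one,
    Matrix.empty_val', Matrix.cons_val_fin_one, mul_zero, zero_mul, add_zero, zero_add] at h01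
  have hab' : (z₀ * a - z₀ * b : ℂ) ≠ 0 := by
    rw [← mul_sub]
    exact mul_ne_zero hz₀ (sub_ne_zero.2 (by exact_mod_cast hab))
  have hz : (z₀ * a - z₀ * b) * (((t : ↥(unitaryGroupOfForm (starRingEnd ℂ) (Matrix.of fun i j : Fin 2 => if i.val + j.val + 1 = 2 then (1 : ℂ) else 0))) : GL (Fin 2) ℂ) : Matrix (Fin 2) (Fin 2) ℂ) 0 1 = 0 := by linear_combination -h01
  rcases mul_eq_zero.1 hz with h0 | h0
  · exact absurd h0 hab'
  · exact h0

/-- … and `t₁₀ = 0`. [cite: BeuzartPlessis2020Asterisque, §1.8 p. 39; §1.2 (1.2.2), (1.2.4) p. 21] -/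
theorem apply_one_zero_eq_zero_of_mem_centralizer (hγ : (((γ : ↥(unitaryGroupOfForm (starRingEnd ℂ) (Matrix.of fun i j : Fin 2 => if i.val + j.val + 1 = 2 then (1 : ℂ) else 0))) : GL (Fin 2) ℂ) : Matrix (Fin 2) (Fin 2) ℂ) = !![z₀ * a, 0; 0, z₀ * b]) (hz₀ : z₀ ≠ 0) (hab : a ≠ b)
    {t : ↥(unitaryGroupOfForm (starRingEnd ℂ) (Matrix.of fun i j : Fin 2 => if i.val + j.val + 1 = 2 then (1 : ℂ) else 0))} (ht : t ∈ Subgroup.centralizer ({γ} : Set ↥(unitaryGroupOfForm (starRingEnd ℂ) (Matrix.of fun i j : Fin 2 => if i.val + j.val + 1 = 2 then (1 : ℂ) else 0)))) : (((t : ↥(unitaryGroupOfForm (starRingEnd ℂ) (Matrix.of fun i j : Fin 2 => if i.val + j.val + 1 = 2 then (1 : ℂ) else 0))) : GL (Fin 2) ℂ) : Matrix (Fin 2) (Fin 2) ℂ) 1 0 = 0 := by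
  have h := Subgroup.mem_centralizer_singleton_iff.1 ht
  have hm : (((t : ↥(unitaryGroupOfForm (starRingEnd ℂ) (Matrix.of fun i j : Fin 2 => if i.val + j.val + 1 = 2 then (1 : ℂ) else 0))) : GL (Fin 2) ℂ) : Matrix (Fin 2) (Fin 2) ℂ) * (((γ : ↥(unitaryGroupOfForm (starRingEnd ℂ) (Matrix.of fun i j : Fin 2 => if i.val + j.val + 1 = 2 then (1 : ℂ) else 0))) : GL (Fin 2) ℂ) : Matrix (Fin 2) (Fin 2) ℂ) = (((γ : ↥(unitaryGroupOfForm (starRingEnd ℂ) (Matrix.of fun i j : Fin 2 => if i.val + j.val + 1 = 2 then (1 : ℂ) else 0))) : GL (Fin 2) ℂ) : Matrix (Fin 2) (Fin 2) ℂ) * (((t : ↥(unitaryGroupOfForm (starRingEnd ℂ) (Matrix.of fun i j : Fin 2 => if i.val + j.val + 1 = 2 then (1 : ℂ) else 0))) : GL (Fin 2) ℂ) : Matrix (Fin 2) (Fin 2) ℂ) := by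
    have := congrArg (fun u : ↥(unitaryGroupOfForm (starRingEnd ℂ) (Matrix.of fun i j : Fin 2 => if i.val + j.val + 1 = 2 then (1 : ℂ) else 0)) => ((u : GL (Fin 2) ℂ) : Matrix (Fin 2) (Fin 2) ℂ)) h
    simpa only [Subgroup.coe_mul, Units.val_mul] using this
  have h10 := congrFun (congrFun hm 1) 0
  simp only [hγ, Matrix.mul_apply, Fin.sum_univ_two, Matrix.of_apply, Matrix.cons_val', Matrix.cons_val_zero, Matrix.cons_val_one,
    Matrix.empty_val', Matrix.cons_val_fin_one, mul_zero, zero_mul, add_zero, zero_add] at h10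
  have hab' : (z₀ * a - z₀ * b : ℂ) ≠ 0 := by
    rw [← mul_sub]
    exact mul_ne_zero hz₀ (sub_ne_zero.2 (by exact_mod_cast hab))
  have hz : (z₀ * a - z₀ * b) * (((t : ↥(unitaryGroupOfForm (starRingEnd ℂ) (Matrix.of fun i j : Fin 2 => if i.val + j.val + 1 = 2 then (1 : ℂ) else 0))) : GL (Fin 2) ℂ) : Matrix (Fin 2) (Fin 2) ℂ) 1 0 = 0 := by linear_combination h10
  rcases mul_eq_zero.1 hz with h0 | h0
  · exact absurd h0 hab'
  · exact h0

/-- The second row of `t · g` for `t ∈ G_γ`: `(t g)₁ⱼ = t₁₁ g₁ⱼ` (since `t₁₀ = 0`). [cite: BeuzartPlessis2020Asterisque, §1.8 p. 39; §1.2 (1.2.2), (1.2.4) p. 21] -/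
theorem mul_apply_one_of_mem_centralizer (hγ : (((γ : ↥(unitaryGroupOfForm (starRingEnd ℂ) (Matrix.of fun i j : Fin 2 => if i.val + j.val + 1 = 2 then (1 : ℂ) else 0))) : GL (Fin 2) ℂ) : Matrix (Fin 2) (Fin 2) ℂ) = !![z₀ * a, 0; 0, z₀ * b]) (hz₀ : z₀ ≠ 0) (hab : a ≠ b)
    {t : ↥(unitaryGroupOfForm (starRingEnd ℂ) (Matrix.of fun i j : Fin 2 => if i.val + j.val + 1 = 2 then (1 : ℂ) else 0))} (ht : t ∈ Subgroup.centralizer ({γ} : Set ↥(unitaryGroupOfForm (starRingEnd ℂ) (Matrix.of fun i j : Fin 2 => if i.val + j.val + 1 = 2 then (1 : ℂ) else 0)))) (g : ↥(unitaryGroupOfForm (starRingEnd ℂ) (Matrix.of fun i j : Fin 2 => if i.val + j.val + 1 = 2 then (1 : ℂ) else 0))) (j : Fin 2) :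
    (((t * g : ↥(unitaryGroupOfForm (starRingEnd ℂ) (Matrix.of fun i j : Fin 2 => if i.val + j.val + 1 = 2 then (1 : ℂ) else 0))) : GL (Fin 2) ℂ) : Matrix (Fin 2) (Fin 2) ℂ) 1 j = (((t : ↥(unitaryGroupOfForm (starRingEnd ℂ) (Matrix.of fun i j : Fin 2 => if i.val + j.val + 1 = 2 then (1 : ℂ) else 0))) : GL (Fin 2) ℂ) : Matrix (Fin 2) (Fin 2) ℂ) 1 1 * (((g : ↥(unitaryGroupOfForm (starRingEnd ℂ) (Matrix.of fun i j : Fin 2 => if i.val + j.val + 1 = 2 then (1 : ℂ) else 0))) : GL (Fin 2) ℂ) : Matrix (Fin 2) (Fin 2) ℂ) 1 j := by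
  rw [show (((t * g : ↥(unitaryGroupOfForm (starRingEnd ℂ) (Matrix.of fun i j : Fin 2 => if i.val + j.val + 1 = 2 then (1 : ℂ) else 0))) : GL (Fin 2) ℂ) : Matrix (Fin 2) (Fin 2) ℂ) = (((t : ↥(unitaryGroupOfForm (starRingEnd ℂ) (Matrix.of fun i j : Fin 2 => if i.val + j.val + 1 = 2 then (1 : ℂ) else 0))) : GL (Fin 2) ℂ) : Matrix (Fin 2) (Fin 2) ℂ) * (((g : ↥(unitaryGroupOfForm (starRingEnd ℂ) (Matrix.of fun i j : Fin 2 => if i.val + j.val + 1 = 2 then (1 : ℂ) else 0))) : GL (Fin 2) ℂ) : Matrix (Fin 2) (Fin 2) ℂ) from by simp only [Subgroup.coe_mul, Units.val_mul], Matrix.mul_apply, Fin.sum_univ_two,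
    apply_one_zero_eq_zero_of_mem_centralizer hγ hz₀ hab ht, zero_mul, zero_add]

/-- The diagonal real matrix `diag(τ⁻¹, τ)` has determinant one (`τ ≠ 0`). [cite: Borel1997, §2.9] -/
theorem det_diag_inv_eq_one {τ : ℝ} (hτ : τ ≠ 0) : (!![τ⁻¹, 0; 0, τ] : Matrix (Fin 2) (Fin 2) ℝ).det = 1 := by
  rw [Matrix.det_fin_two_of]; simp [hτ]

/-- The underlying matrix of the lifted real torus element `d_τ(z) = lift(z, diag(τ⁻¹, τ))` is `diag(z τ⁻¹, z τ)`. [cite: Borel1997, §4.1 (1)–(3)] -/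
theorem coe_lift_diag (z : Circle) {τ : ℝ} (hτ : τ ≠ 0) :
    (((archPlaneLiftUnitary (z, !![τ⁻¹, 0; 0, τ]) : ↥(unitaryGroupOfForm (starRingEnd ℂ) (Matrix.of fun i j : Fin 2 => if i.val + j.val + 1 = 2 then (1 : ℂ) else 0))) : GL (Fin 2) ℂ) : Matrix (Fin 2) (Fin 2) ℂ) = !![(z : ℂ) * (τ : ℂ)⁻¹, 0; 0, (z : ℂ) * τ] := by
  rw [coe_archPlaneLiftUnitary (p := (z, (!![τ⁻¹, 0; 0, τ] : Matrix (Fin 2) (Fin 2) ℝ))) (det_diag_inv_eq_one hτ)]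
  ext i j
  fin_cases i <;> fin_cases j <;> simp [archPlaneLift, Complex.ofReal_inv]

/-- The lifted real torus elements `d_τ(z)` CENTRALISE the split `γ` (both are diagonal). [cite: BeuzartPlessis2020Asterisque, §1.8 p. 39; §1.2 (1.2.2), (1.2.4) p. 21] -/
theorem lift_diag_mem_centralizer (hγ : (((γ : ↥(unitaryGroupOfForm (starRingEnd ℂ) (Matrix.of fun i j : Fin 2 => if i.val + j.val + 1 = 2 then (1 : ℂ) else 0))) : GL (Fin 2) ℂ) : Matrix (Fin 2) (Fin 2) ℂ) = !![z₀ * a, 0; 0, z₀ * b]) (z : Circle) {τ : ℝ} (hτ : τ ≠ 0) :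
    archPlaneLiftUnitary (z, !![τ⁻¹, 0; 0, τ]) ∈ Subgroup.centralizer ({γ} : Set ↥(unitaryGroupOfForm (starRingEnd ℂ) (Matrix.of fun i j : Fin 2 => if i.val + j.val + 1 = 2 then (1 : ℂ) else 0))) := by
  rw [Subgroup.mem_centralizer_singleton_iff]
  apply Subtype.ext
  apply Units.ext
  simp only [Subgroup.coe_mul, Units.val_mul]
  rw [coe_lift_diag z hτ, hγ]
  ext i j
  fin_cases i <;> fin_cases j <;> simp [Matrix.mul_apply, Fin.sum_univ_two] <;> ring

/-- `χ(t) = |t₁₁|²` is MULTIPLICATIVE on the centraliser: `|(t t′)₁₁|² = |t₁₁|² |t′₁₁|²`. [cite: BeuzartPlessis2020Asterisque, §1.8 p. 39; §1.2 (1.2.2), (1.2.4) p. 21] -/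
theorem normSq_apply_one_one_mul (hγ : (((γ : ↥(unitaryGroupOfForm (starRingEnd ℂ) (Matrix.of fun i j : Fin 2 => if i.val + j.val + 1 = 2 then (1 : ℂ) else 0))) : GL (Fin 2) ℂ) : Matrix (Fin 2) (Fin 2) ℂ) = !![z₀ * a, 0; 0, z₀ * b]) (hz₀ : z₀ ≠ 0) (hab : a ≠ b)
    {t : ↥(unitaryGroupOfForm (starRingEnd ℂ) (Matrix.of fun i j : Fin 2 => if i.val + j.val + 1 = 2 then (1 : ℂ) else 0))} (ht : t ∈ Subgroup.centralizer ({γ} : Set ↥(unitaryGroupOfForm (starRingEnd ℂ) (Matrix.of fun i j : Fin 2 => if i.val + j.val + 1 = 2 then (1 : ℂ) else 0)))) (g : ↥(unitaryGroupOfForm (starRingEnd ℂ) (Matrix.of fun i j : Fin 2 => if i.val + j.val + 1 = 2 then (1 : ℂ) else 0))) :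
    ‖(((t * g : ↥(unitaryGroupOfForm (starRingEnd ℂ) (Matrix.of fun i j : Fin 2 => if i.val + j.val + 1 = 2 then (1 : ℂ) else 0))) : GL (Fin 2) ℂ) : Matrix (Fin 2) (Fin 2) ℂ) 1 1‖ ^ 2 = ‖(((t : ↥(unitaryGroupOfForm (starRingEnd ℂ) (Matrix.of fun i j : Fin 2 => if i.val + j.val + 1 = 2 then (1 : ℂ) else 0))) : GL (Fin 2) ℂ) : Matrix (Fin 2) (Fin 2) ℂ) 1 1‖ ^ 2 * ‖(((g : ↥(unitaryGroupOfForm (starRingEnd ℂ) (Matrix.of fun i j : Fin 2 => if i.val + j.val + 1 = 2 then (1 : ℂ) else 0))) : GL (Fin 2) ℂ) : Matrix (Fin 2) (Fin 2) ℂ) 1 1‖ ^ 2 := by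
  rw [mul_apply_one_of_mem_centralizer hγ hz₀ hab ht g 1, norm_mul, mul_pow]

/-- The function `χ(t) = |t₁₁|²` is continuous on the centraliser. [cite: BeuzartPlessis2020Asterisque, §1.8 p. 39; §1.2 (1.2.2), (1.2.4) p. 21] -/
theorem continuous_normSq_apply_one_one_centralizer (γ : ↥(unitaryGroupOfForm (starRingEnd ℂ) (Matrix.of fun i j : Fin 2 => if i.val + j.val + 1 = 2 then (1 : ℂ) else 0))) :
    Continuous fun t : ↥(Subgroup.centralizer ({γ} : Set ↥(unitaryGroupOfForm (starRingEnd ℂ) (Matrix.of fun i j : Fin 2 => if i.val + j.val + 1 = 2 then (1 : ℂ) else 0)))) => ‖((((t : ↥(unitaryGroupOfForm (starRingEnd ℂ) (Matrix.of fun i j : Fin 2 => if i.val + j.val + 1 = 2 then (1 : ℂ) else 0))) : ↥(unitaryGroupOfForm (starRingEnd ℂ) (Matrix.of fun i j : Fin 2 => if i.val + j.val + 1 = 2 then (1 : ℂ) else 0))) : GL (Fin 2) ℂ) : Matrix (Fin 2) (Fin 2) ℂ) 1 1‖ ^ 2 := by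
  have hv : Continuous fun t : ↥(Subgroup.centralizer ({γ} : Set ↥(unitaryGroupOfForm (starRingEnd ℂ) (Matrix.of fun i j : Fin 2 => if i.val + j.val + 1 = 2 then (1 : ℂ) else 0)))) => ((((t : ↥(unitaryGroupOfForm (starRingEnd ℂ) (Matrix.of fun i j : Fin 2 => if i.val + j.val + 1 = 2 then (1 : ℂ) else 0))) : ↥(unitaryGroupOfForm (starRingEnd ℂ) (Matrix.of fun i j : Fin 2 => if i.val + j.val + 1 = 2 then (1 : ℂ) else 0))) : GL (Fin 2) ℂ) : Matrix (Fin 2) (Fin 2) ℂ) :=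
    Units.continuous_val.comp (continuous_subtype_val.comp continuous_subtype_val)
  exact (((continuous_apply 1).comp ((continuous_apply 1).comp hv)).norm).pow 2

/-- Every `t ∈ G_γ` is a lifted torus element: `t = lift(z, diag(τ⁻¹, τ))` with `τ = |t₁₁| > 0`, `z = t₁₁∕|t₁₁| ∈ S¹` (diagonal, `Φ₂`-unitary ⇒ `t̄₀₀ t₁₁ = 1`).
[cite: Borel1997, §4.1 (1)–(3)] -/
theorem exists_eq_lift_diag_of_mem_centralizer (hγ : (((γ : ↥(unitaryGroupOfForm (starRingEnd ℂ) (Matrix.of fun i j : Fin 2 => if i.val + j.val + 1 = 2 then (1 : ℂ) else 0))) : GL (Fin 2) ℂ) : Matrix (Fin 2) (Fin 2) ℂ) = !![z₀ * a, 0; 0, z₀ * b]) (hz₀ : z₀ ≠ 0) (hab : a ≠ b)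
    {t : ↥(unitaryGroupOfForm (starRingEnd ℂ) (Matrix.of fun i j : Fin 2 => if i.val + j.val + 1 = 2 then (1 : ℂ) else 0))} (ht : t ∈ Subgroup.centralizer ({γ} : Set ↥(unitaryGroupOfForm (starRingEnd ℂ) (Matrix.of fun i j : Fin 2 => if i.val + j.val + 1 = 2 then (1 : ℂ) else 0)))) :
    ∃ (z : Circle) (τ : ℝ), 0 < τ ∧ τ = ‖(((t : ↥(unitaryGroupOfForm (starRingEnd ℂ) (Matrix.of fun i j : Fin 2 => if i.val + j.val + 1 = 2 then (1 : ℂ) else 0))) : GL (Fin 2) ℂ) : Matrix (Fin 2) (Fin 2) ℂ) 1 1‖ ∧ t = archPlaneLiftUnitary (z, !![τ⁻¹, 0; 0, τ]) := by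
  have h01 := apply_zero_one_eq_zero_of_mem_centralizer hγ hz₀ hab ht
  have h10 := apply_one_zero_eq_zero_of_mem_centralizer hγ hz₀ hab ht
  -- unitarity: `conj t₀₀ * t₁₁ = 1`
  have hu := mem_unitaryGroupOfForm_iff.1 t.2
  have hu01 := congrFun (congrFun hu 0) 1
  simp only [Matrix.mul_apply, Fin.sum_univ_two, Matrix.transpose_apply, Matrix.map_apply, Matrix.of_apply, h01, h10] at hu01
  norm_num at hu01
  -- hu01 : conj t₀₀ * t₁₁ = 1 (in some normal form)
  have h11 : (((t : ↥(unitaryGroupOfForm (starRingEnd ℂ) (Matrix.of fun i j : Fin 2 => if i.val + j.val + 1 = 2 then (1 : ℂ) else 0))) : GL (Fin 2) ℂ) : Matrix (Fin 2) (Fin 2) ℂ) 1 1 ≠ 0 := by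
    intro h0; rw [h0] at hu01; simp at hu01
  set τ : ℝ := ‖(((t : ↥(unitaryGroupOfForm (starRingEnd ℂ) (Matrix.of fun i j : Fin 2 => if i.val + j.val + 1 = 2 then (1 : ℂ) else 0))) : GL (Fin 2) ℂ) : Matrix (Fin 2) (Fin 2) ℂ) 1 1‖ with hτ
  have hτ0 : 0 < τ := norm_pos_iff.2 h11
  set zc : ℂ := (((t : ↥(unitaryGroupOfForm (starRingEnd ℂ) (Matrix.of fun i j : Fin 2 => if i.val + j.val + 1 = 2 then (1 : ℂ) else 0))) : GL (Fin 2) ℂ) : Matrix (Fin 2) (Fin 2) ℂ) 1 1 * (τ : ℂ)⁻¹ with hzc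
  have hzc1 : ‖zc‖ = 1 := by
    rw [hzc, norm_mul, norm_inv, Complex.norm_real, Real.norm_eq_abs, abs_of_pos hτ0, hτ, mul_inv_cancel₀ (norm_ne_zero_iff.2 h11)]
  let z : Circle := ⟨zc, mem_sphere_zero_iff_norm.2 hzc1⟩
  refine ⟨z, τ, hτ0, rfl, ?_⟩
  apply Subtype.ext
  apply Units.ext
  rw [coe_lift_diag z hτ0.ne']
  -- entries
  have h00 : (((t : ↥(unitaryGroupOfForm (starRingEnd ℂ) (Matrix.of fun i j : Fin 2 => if i.val + j.val + 1 = 2 then (1 : ℂ) else 0))) : GL (Fin 2) ℂ) : Matrix (Fin 2) (Fin 2) ℂ) 0 0 = zc * (τ : ℂ)⁻¹ := by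
    -- from `conj t₀₀ * t₁₁ = 1`: `t₀₀ = 1 / conj t₁₁ = t₁₁ / |t₁₁|²`
    have hns : (τ : ℂ) * τ = (((t : ↥(unitaryGroupOfForm (starRingEnd ℂ) (Matrix.of fun i j : Fin 2 => if i.val + j.val + 1 = 2 then (1 : ℂ) else 0))) : GL (Fin 2) ℂ) : Matrix (Fin 2) (Fin 2) ℂ) 1 1 * conj ((((t : ↥(unitaryGroupOfForm (starRingEnd ℂ) (Matrix.of fun i j : Fin 2 => if i.val + j.val + 1 = 2 then (1 : ℂ) else 0))) : GL (Fin 2) ℂ) : Matrix (Fin 2) (Fin 2) ℂ) 1 1) := by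
      rw [hτ, Complex.mul_conj, Complex.normSq_eq_norm_sq]; push_cast; ring
    have hτc : (τ : ℂ) ≠ 0 := by exact_mod_cast hτ0.ne'
    have hc11 : conj ((((t : ↥(unitaryGroupOfForm (starRingEnd ℂ) (Matrix.of fun i j : Fin 2 => if i.val + j.val + 1 = 2 then (1 : ℂ) else 0))) : GL (Fin 2) ℂ) : Matrix (Fin 2) (Fin 2) ℂ) 1 1) ≠ 0 := (map_ne_zero _).2 h11
    rw [hzc]
    field_simp
    -- goal: t₀₀ * τ * τ = t₁₁  (shape may differ)
    have key : (((t : ↥(unitaryGroupOfForm (starRingEnd ℂ) (Matrix.of fun i j : Fin 2 => if i.val + j.val + 1 = 2 then (1 : ℂ) else 0))) : GL (Fin 2) ℂ) : Matrix (Fin 2) (Fin 2) ℂ) 0 0 * conj ((((t : ↥(unitaryGroupOfForm (starRingEnd ℂ) (Matrix.of fun i j : Fin 2 => if i.val + j.val + 1 = 2 then (1 : ℂ) else 0))) : GL (Fin 2) ℂ) : Matrix (Fin 2) (Fin 2) ℂ) 1 1) = 1 := by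
      have := congrArg conj hu01
      simpa [map_mul] using this
    linear_combination ((((t : ↥(unitaryGroupOfForm (starRingEnd ℂ) (Matrix.of fun i j : Fin 2 => if i.val + j.val + 1 = 2 then (1 : ℂ) else 0))) : GL (Fin 2) ℂ) : Matrix (Fin 2) (Fin 2) ℂ) 0 0) * hns + ((((t : ↥(unitaryGroupOfForm (starRingEnd ℂ) (Matrix.of fun i j : Fin 2 => if i.val + j.val + 1 = 2 then (1 : ℂ) else 0))) : GL (Fin 2) ℂ) : Matrix (Fin 2) (Fin 2) ℂ) 1 1) * key
  ext i j
  fin_cases i <;> fin_cases j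
  · simpa using h00
  · simpa using h01
  · simpa using h10
  · show (((t : ↥(unitaryGroupOfForm (starRingEnd ℂ) (Matrix.of fun i j : Fin 2 => if i.val + j.val + 1 = 2 then (1 : ℂ) else 0))) : GL (Fin 2) ℂ) : Matrix (Fin 2) (Fin 2) ℂ) 1 1 = (z : ℂ) * τ
    change (((t : ↥(unitaryGroupOfForm (starRingEnd ℂ) (Matrix.of fun i j : Fin 2 => if i.val + j.val + 1 = 2 then (1 : ℂ) else 0))) : GL (Fin 2) ℂ) : Matrix (Fin 2) (Fin 2) ℂ) 1 1 = zc * τ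
    rw [hzc, mul_assoc, inv_mul_cancel₀ (by exact_mod_cast hτ0.ne' : (τ : ℂ) ≠ 0), mul_one]

/-- The lift `(z, τ) ↦ lift(z, diag(τ⁻¹, τ)) ∈ G` is continuous on `S¹ × (0, ∞)` (entries `z τ^{∓1}`; the inverse is the lift of `(z̄, diag(τ, τ⁻¹))`).
[cite: Borel1997, §4.1 (1)–(3)] -/
theorem continuousOn_lift_diag :
    ContinuousOn (fun p : Circle × ℝ => archPlaneLiftUnitary (p.1, !![p.2⁻¹, 0; 0, p.2])) ((univ : Set Circle) ×ˢ Ioi (0 : ℝ)) := by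
  rw [continuousOn_iff_continuous_restrict]
  have hτ : ∀ q : ↥((univ : Set Circle) ×ˢ Ioi (0 : ℝ)), (q : Circle × ℝ).2 ≠ 0 := fun q => by
    have h : (0 : ℝ) < (q : Circle × ℝ).2 := Set.mem_Ioi.1 q.2.2
    exact h.ne'
  have hdet : ∀ q : ↥((univ : Set Circle) ×ˢ Ioi (0 : ℝ)), (!![(q : Circle × ℝ).2⁻¹, 0; 0, (q : Circle × ℝ).2] : Matrix (Fin 2) (Fin 2) ℝ).det = 1 :=
    fun q => det_diag_inv_eq_one (hτ q)
  -- rewrite the restricted map through the `dif_pos` branch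
  have e : ((univ : Set Circle) ×ˢ Ioi (0 : ℝ)).restrict (fun p : Circle × ℝ => archPlaneLiftUnitary (p.1, !![p.2⁻¹, 0; 0, p.2])) =
      fun q : ↥((univ : Set Circle) ×ˢ Ioi (0 : ℝ)) => (⟨archPlaneLiftGL (q : Circle × ℝ).1 _ (hdet q), archPlaneLiftGL_mem_unitaryGroupOfForm _ _ (hdet q)⟩ : ↥(unitaryGroupOfForm (starRingEnd ℂ) (Matrix.of fun i j : Fin 2 => if i.val + j.val + 1 = 2 then (1 : ℂ) else 0))) := by
    funext q
    simp only [Set.restrict_apply]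
    have h : ((q : Circle × ℝ).1, (!![(q : Circle × ℝ).2⁻¹, 0; 0, (q : Circle × ℝ).2] : Matrix (Fin 2) (Fin 2) ℝ)) ∈
        {p : Circle × Matrix (Fin 2) (Fin 2) ℝ | p.2.det = 1} := hdet q
    simp only [archPlaneLiftUnitary, dif_pos h]
  rw [e]
  refine Continuous.subtype_mk ?_ _
  have hM : Continuous fun q : ↥((univ : Set Circle) ×ˢ Ioi (0 : ℝ)) => (!![(q : Circle × ℝ).2⁻¹, 0; 0, (q : Circle × ℝ).2] : Matrix (Fin 2) (Fin 2) ℝ) := by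
    have h2 : Continuous fun q : ↥((univ : Set Circle) ×ˢ Ioi (0 : ℝ)) => (q : Circle × ℝ).2 := continuous_snd.comp continuous_subtype_val
    have h2i : Continuous fun q : ↥((univ : Set Circle) ×ˢ Ioi (0 : ℝ)) => ((q : Circle × ℝ).2)⁻¹ := h2.inv₀ hτ
    refine continuous_matrix fun i j => ?_
    fin_cases i <;> fin_cases j
    · exact h2i
    · exact continuous_const
    · exact continuous_const
    · exact h2
  have hz : Continuous fun q : ↥((univ : Set Circle) ×ˢ Ioi (0 : ℝ)) => ((q : Circle × ℝ).1 : ℂ) :=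
    continuous_subtype_val.comp (continuous_fst.comp continuous_subtype_val)
  refine Units.continuous_iff.2 ⟨?_, ?_⟩
  · show Continuous fun q : ↥((univ : Set Circle) ×ˢ Ioi (0 : ℝ)) => archPlaneLift ((q : Circle × ℝ).1 : ℂ) !![(q : Circle × ℝ).2⁻¹, 0; 0, (q : Circle × ℝ).2]
    exact continuous_archPlaneLift_uncurry'.comp (hz.prodMk hM)
  · show Continuous fun q : ↥((univ : Set Circle) ×ˢ Ioi (0 : ℝ)) =>
        archPlaneLift (conj ((q : Circle × ℝ).1 : ℂ)) (!![(q : Circle × ℝ).2⁻¹, 0; 0, (q : Circle × ℝ).2] : Matrix (Fin 2) (Fin 2) ℝ).adjugate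
    exact continuous_archPlaneLift_uncurry'.comp ((Complex.continuous_conj.comp hz).prodMk hM.matrix_adjugate)

/-- **The `χ`-shell `{t ∈ G_γ ∣ |t₁₁|² ∈ [1, 2]}` is COMPACT** (it is closed and lies in the image of the compact `S¹ × [1, √2]` under the continuous lift).
[cite: BeuzartPlessis2020Asterisque, §1.8 p. 39; §1.2 (1.2.2), (1.2.4) p. 21] -/
theorem isCompact_chi_Icc (hγ : (((γ : ↥(unitaryGroupOfForm (starRingEnd ℂ) (Matrix.of fun i j : Fin 2 => if i.val + j.val + 1 = 2 then (1 : ℂ) else 0))) : GL (Fin 2) ℂ) : Matrix (Fin 2) (Fin 2) ℂ) = !![z₀ * a, 0; 0, z₀ * b]) (hz₀ : z₀ ≠ 0) (hab : a ≠ b) :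
    IsCompact {t : ↥(Subgroup.centralizer ({γ} : Set ↥(unitaryGroupOfForm (starRingEnd ℂ) (Matrix.of fun i j : Fin 2 => if i.val + j.val + 1 = 2 then (1 : ℂ) else 0)))) | ‖((((t : ↥(unitaryGroupOfForm (starRingEnd ℂ) (Matrix.of fun i j : Fin 2 => if i.val + j.val + 1 = 2 then (1 : ℂ) else 0))) : ↥(unitaryGroupOfForm (starRingEnd ℂ) (Matrix.of fun i j : Fin 2 => if i.val + j.val + 1 = 2 then (1 : ℂ) else 0))) : GL (Fin 2) ℂ) : Matrix (Fin 2) (Fin 2) ℂ) 1 1‖ ^ 2 ∈ Icc 1 2} := by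
  -- the compact image in `G`
  have hK : IsCompact ((fun p : Circle × ℝ => archPlaneLiftUnitary (p.1, !![p.2⁻¹, 0; 0, p.2])) '' ((univ : Set Circle) ×ˢ Icc (1 : ℝ) (Real.sqrt 2))) :=
    (isCompact_univ.prod isCompact_Icc).image_of_continuousOn
      (continuousOn_lift_diag.mono (Set.prod_mono le_rfl fun τ hτ => lt_of_lt_of_le one_pos hτ.1))
  -- closedness in `G` of `T ∩ {χ ∈ [1,2]}`
  have hv : Continuous fun u : ↥(unitaryGroupOfForm (starRingEnd ℂ) (Matrix.of fun i j : Fin 2 => if i.val + j.val + 1 = 2 then (1 : ℂ) else 0)) => (((u : ↥(unitaryGroupOfForm (starRingEnd ℂ) (Matrix.of fun i j : Fin 2 => if i.val + j.val + 1 = 2 then (1 : ℂ) else 0))) : GL (Fin 2) ℂ) : Matrix (Fin 2) (Fin 2) ℂ) := Units.continuous_val.comp continuous_subtype_val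
  have hχG : Continuous fun u : ↥(unitaryGroupOfForm (starRingEnd ℂ) (Matrix.of fun i j : Fin 2 => if i.val + j.val + 1 = 2 then (1 : ℂ) else 0)) => ‖(((u : ↥(unitaryGroupOfForm (starRingEnd ℂ) (Matrix.of fun i j : Fin 2 => if i.val + j.val + 1 = 2 then (1 : ℂ) else 0))) : GL (Fin 2) ℂ) : Matrix (Fin 2) (Fin 2) ℂ) 1 1‖ ^ 2 :=
    (((continuous_apply 1).comp ((continuous_apply 1).comp hv)).norm).pow 2
  have hclosed : IsClosed ({u : ↥(unitaryGroupOfForm (starRingEnd ℂ) (Matrix.of fun i j : Fin 2 => if i.val + j.val + 1 = 2 then (1 : ℂ) else 0)) | u ∈ Subgroup.centralizer ({γ} : Set ↥(unitaryGroupOfForm (starRingEnd ℂ) (Matrix.of fun i j : Fin 2 => if i.val + j.val + 1 = 2 then (1 : ℂ) else 0)))} ∩ {u | ‖(((u : ↥(unitaryGroupOfForm (starRingEnd ℂ) (Matrix.of fun i j : Fin 2 => if i.val + j.val + 1 = 2 then (1 : ℂ) else 0))) : GL (Fin 2) ℂ) : Matrix (Fin 2) (Fin 2) ℂ) 1 1‖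 ^ 2 ∈ Icc 1 2}) :=
    (Set.isClosed_centralizer ({γ} : Set ↥(unitaryGroupOfForm (starRingEnd ℂ) (Matrix.of fun i j : Fin 2 => if i.val + j.val + 1 = 2 then (1 : ℂ) else 0)))).inter (isClosed_Icc.preimage hχG)
  -- the image of our set under the inclusion `T → G` is that closed set, contained in the compact image
  rw [Subtype.isCompact_iff]
  have himg : ((↑) : ↥(Subgroup.centralizer ({γ} : Set ↥(unitaryGroupOfForm (starRingEnd ℂ) (Matrix.of fun i j : Fin 2 => if i.val + j.val + 1 = 2 then (1 : ℂ) else 0)))) → ↥(unitaryGroupOfForm (starRingEnd ℂ) (Matrix.of fun i j : Fin 2 => if i.val + j.val + 1 = 2 then (1 : ℂ) else 0))) '' {t | ‖((((t : ↥(unitaryGroupOfForm (starRingEnd ℂ) (Matrix.of fun i j : Fin 2 => if i.val + j.val + 1 = 2 then (1 : ℂ) else 0))) : ↥(unitaryGroupOfForm (starRingEnd ℂ) (Matrix.of fun i j : Fin 2 => if i.val + j.val + 1 = 2 then (1 : ℂ) else 0))) : GL (Fin 2) ℂ) : Matrix (Fin 2) (Fin 2) ℂ) 1 1‖ ^ 2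 ∈ Icc 1 2} =
      {u : ↥(unitaryGroupOfForm (starRingEnd ℂ) (Matrix.of fun i j : Fin 2 => if i.val + j.val + 1 = 2 then (1 : ℂ) else 0)) | u ∈ Subgroup.centralizer ({γ} : Set ↥(unitaryGroupOfForm (starRingEnd ℂ) (Matrix.of fun i j : Fin 2 => if i.val + j.val + 1 = 2 then (1 : ℂ) else 0)))} ∩ {u | ‖(((u : ↥(unitaryGroupOfForm (starRingEnd ℂ) (Matrix.of fun i j : Fin 2 => if i.val + j.val + 1 = 2 then (1 : ℂ) else 0))) : GL (Fin 2) ℂ) : Matrix (Fin 2) (Fin 2) ℂ) 1 1‖ ^ 2 ∈ Icc 1 2} := by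
    ext u
    constructor
    · rintro ⟨t, ht, rfl⟩; exact ⟨t.2, ht⟩
    · rintro ⟨hu, hχ⟩; exact ⟨⟨u, hu⟩, hχ, rfl⟩
  rw [himg]
  refine hK.of_isClosed_subset hclosed ?_
  rintro u ⟨hu, hχ1, hχ2⟩
  obtain ⟨z, τ, hτ0, hτ, hu'⟩ := exists_eq_lift_diag_of_mem_centralizer hγ hz₀ hab hu
  refine ⟨(z, τ), ⟨mem_univ _, ?_, ?_⟩, hu'.symm⟩
  · have h1 : 1 ≤ τ ^ 2 := by rw [hτ]; exact hχ1
    nlinarith [h1, hτ0]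
  · have h2 : τ ^ 2 ≤ 2 := by rw [hτ]; exact hχ2
    exact le_trans (le_abs_self τ) (Real.abs_le_sqrt h2)

variable [MeasurableSpace ↥(unitaryGroupOfForm (starRingEnd ℂ) (Matrix.of fun i j : Fin 2 => if i.val + j.val + 1 = 2 then (1 : ℂ) else 0))] [BorelSpace ↥(unitaryGroupOfForm (starRingEnd ℂ) (Matrix.of fun i j : Fin 2 => if i.val + j.val + 1 = 2 then (1 : ℂ) else 0))]

/-- **`s`-INDEPENDENCE OF THE TORUS MASS OF A `χ`-SHELL** (left invariance of `ρ` alone): for every left-invariant measure `ρ` on `G_γ` and every `s > 0`,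
`ρ {t ∣ |t₁₁|² ∈ [s, 2s]} = ρ {t ∣ |t₁₁|² ∈ [1, 2]}` — translate by the real element `d_{√s} ∈ G_γ` (`χ(d_{√s} t) = s χ(t)`).
[cite: BeuzartPlessis2020Asterisque, §1.8 p. 39; §1.2 (1.2.2), (1.2.4) p. 21] -/
theorem measure_chi_Icc_eq (hγ : (((γ : ↥(unitaryGroupOfForm (starRingEnd ℂ) (Matrix.of fun i j : Fin 2 => if i.val + j.val + 1 = 2 then (1 : ℂ) else 0))) : GL (Fin 2) ℂ) : Matrix (Fin 2) (Fin 2) ℂ) = !![z₀ * a, 0; 0, z₀ * b]) (hz₀ : z₀ ≠ 0) (hab : a ≠ b)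
    (ρ : Measure ↥(Subgroup.centralizer ({γ} : Set ↥(unitaryGroupOfForm (starRingEnd ℂ) (Matrix.of fun i j : Fin 2 => if i.val + j.val + 1 = 2 then (1 : ℂ) else 0))))) [ρ.IsMulLeftInvariant] {s : ℝ} (hs : 0 < s) :
    ρ {t | ‖((((t : ↥(unitaryGroupOfForm (starRingEnd ℂ) (Matrix.of fun i j : Fin 2 => if i.val + j.val + 1 = 2 then (1 : ℂ) else 0))) : ↥(unitaryGroupOfForm (starRingEnd ℂ) (Matrix.of fun i j : Fin 2 => if i.val + j.val + 1 = 2 then (1 : ℂ) else 0))) : GL (Fin 2) ℂ) : Matrix (Fin 2) (Fin 2) ℂ) 1 1‖ ^ 2 ∈ Icc s (2 * s)} = ρ {t | ‖((((t : ↥(unitaryGroupOfForm (starRingEnd ℂ) (Matrix.of fun i j : Fin 2 => if i.val + j.val + 1 = 2 then (1 : ℂ) else 0))) : ↥(unitaryGroupOfForm (starRingEnd ℂ) (Matrix.of fun i j : Fin 2 => if i.val + j.val + 1 = 2 then (1 : ℂ) else 0))) : GL (Fin 2) ℂ) : Matrix (Fin 2) (Fin 2) ℂ) 1 1‖ ^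 2 ∈ Icc 1 2} := by
  have hτ : Real.sqrt s ≠ 0 := (Real.sqrt_pos.2 hs).ne'
  set t₀ : ↥(Subgroup.centralizer ({γ} : Set ↥(unitaryGroupOfForm (starRingEnd ℂ) (Matrix.of fun i j : Fin 2 => if i.val + j.val + 1 = 2 then (1 : ℂ) else 0)))) :=
    ⟨archPlaneLiftUnitary ((1 : Circle), !![(Real.sqrt s)⁻¹, 0; 0, Real.sqrt s]), lift_diag_mem_centralizer hγ 1 hτ⟩ with ht₀
  have hχ₀ : ‖((((t₀ : ↥(unitaryGroupOfForm (starRingEnd ℂ) (Matrix.of fun i j : Fin 2 => if i.val + j.val + 1 = 2 then (1 : ℂ) else 0))) : ↥(unitaryGroupOfForm (starRingEnd ℂ) (Matrix.of fun i j : Fin 2 => if i.val + j.val + 1 = 2 then (1 : ℂ) else 0))) : GL (Fin 2) ℂ) : Matrix (Fin 2) (Fin 2) ℂ) 1 1‖ ^ 2 = s := by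
    rw [ht₀]
    rw [coe_lift_diag 1 hτ]
    simp [Complex.norm_real, Real.sq_sqrt hs.le, abs_of_nonneg (Real.sqrt_nonneg s)]
  -- `{χ ∈ [1, 2]} = (t₀ * ·)⁻¹' {χ ∈ [s, 2s]}`
  have hpre : {t : ↥(Subgroup.centralizer ({γ} : Set ↥(unitaryGroupOfForm (starRingEnd ℂ) (Matrix.of fun i j : Fin 2 => if i.val + j.val + 1 = 2 then (1 : ℂ) else 0)))) | ‖((((t : ↥(unitaryGroupOfForm (starRingEnd ℂ) (Matrix.of fun i j : Fin 2 => if i.val + j.val + 1 = 2 then (1 : ℂ) else 0))) : ↥(unitaryGroupOfForm (starRingEnd ℂ) (Matrix.of fun i j : Fin 2 => if i.val + j.val + 1 = 2 then (1 : ℂ) else 0))) : GL (Fin 2) ℂ) : Matrix (Fin 2) (Fin 2) ℂ) 1 1‖ ^ 2 ∈ Icc 1 2} =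
      (fun t => t₀ * t) ⁻¹' {t | ‖((((t : ↥(unitaryGroupOfForm (starRingEnd ℂ) (Matrix.of fun i j : Fin 2 => if i.val + j.val + 1 = 2 then (1 : ℂ) else 0))) : ↥(unitaryGroupOfForm (starRingEnd ℂ) (Matrix.of fun i j : Fin 2 => if i.val + j.val + 1 = 2 then (1 : ℂ) else 0))) : GL (Fin 2) ℂ) : Matrix (Fin 2) (Fin 2) ℂ) 1 1‖ ^ 2 ∈ Icc s (2 * s)} := by
    ext t
    simp only [Set.mem_setOf_eq, Set.mem_preimage, Set.mem_Icc]
    have e : ‖(((((t₀ * t : ↥(Subgroup.centralizer ({γ} : Set ↥(unitaryGroupOfForm (starRingEnd ℂ) (Matrix.of fun i j : Fin 2 => if i.val + j.val + 1 = 2 then (1 : ℂ) else 0))))) : ↥(unitaryGroupOfForm (starRingEnd ℂ) (Matrix.of fun i j : Fin 2 => if i.val + j.val + 1 = 2 then (1 : ℂ) else 0))) : ↥(unitaryGroupOfForm (starRingEnd ℂ) (Matrix.of fun i j : Fin 2 => if i.val + j.val + 1 = 2 then (1 : ℂ) else 0))) : GL (Fin 2) ℂ) : Matrix (Fin 2)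 (Fin 2) ℂ) 1 1‖ ^ 2 = s * ‖(((((t : ↥(Subgroup.centralizer ({γ} : Set ↥(unitaryGroupOfForm (starRingEnd ℂ) (Matrix.of fun i j : Fin 2 => if i.val + j.val + 1 = 2 then (1 : ℂ) else 0))))) : ↥(unitaryGroupOfForm (starRingEnd ℂ) (Matrix.of fun i j : Fin 2 => if i.val + j.val + 1 = 2 then (1 : ℂ) else 0))) : ↥(unitaryGroupOfForm (starRingEnd ℂ) (Matrix.of fun i j : Fin 2 => if i.val + j.val + 1 = 2 then (1 : ℂ) else 0))) : GL (Fin 2) ℂ) : Matrix (Fin 2) (Fin 2) ℂ) 1 1‖ ^ 2 := by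
      have h1 : ((t₀ * t : ↥(Subgroup.centralizer ({γ} : Set ↥(unitaryGroupOfForm (starRingEnd ℂ) (Matrix.of fun i j : Fin 2 => if i.val + j.val + 1 = 2 then (1 : ℂ) else 0))))) : ↥(unitaryGroupOfForm (starRingEnd ℂ) (Matrix.of fun i j : Fin 2 => if i.val + j.val + 1 = 2 then (1 : ℂ) else 0))) = (t₀ : ↥(unitaryGroupOfForm (starRingEnd ℂ) (Matrix.of fun i j : Fin 2 => if i.val + j.val + 1 = 2 then (1 : ℂ) else 0))) * (t : ↥(unitaryGroupOfForm (starRingEnd ℂ) (Matrix.of fun i j : Fin 2 => if i.val + j.val + 1 = 2 then (1 : ℂ) else 0))) := rfl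
      rw [h1, normSq_apply_one_one_mul hγ hz₀ hab t₀.2 (t : ↥(unitaryGroupOfForm (starRingEnd ℂ) (Matrix.of fun i j : Fin 2 => if i.val + j.val + 1 = 2 then (1 : ℂ) else 0))), hχ₀]
    rw [e]
    constructor
    · rintro ⟨h1, h2⟩; exact ⟨by nlinarith, by nlinarith⟩
    · rintro ⟨h1, h2⟩; exact ⟨by nlinarith, by nlinarith⟩
  rw [hpre, measure_preimage_mul]


omit [BorelSpace ↥(unitaryGroupOfForm (starRingEnd ℂ) (Matrix.of fun i j : Fin 2 => if i.val + j.val + 1 = 2 then (1 : ℂ) else 0))] in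
/-- The `χ`-shell `{t ∈ G_γ ∣ |t₁₁|² ∈ [1, 2]}` has FINITE mass for every measure finite on compacts. [cite: BeuzartPlessis2020Asterisque, §1.8 p. 39; §1.2 (1.2.2), (1.2.4) p. 21] -/
theorem measure_chi_Icc_lt_top (hγ : (((γ : ↥(unitaryGroupOfForm (starRingEnd ℂ) (Matrix.of fun i j : Fin 2 => if i.val + j.val + 1 = 2 then (1 : ℂ) else 0))) : GL (Fin 2) ℂ) : Matrix (Fin 2) (Fin 2) ℂ) = !![z₀ * a, 0; 0, z₀ * b]) (hz₀ : z₀ ≠ 0) (hab : a ≠ b)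
    (ρ : Measure ↥(Subgroup.centralizer ({γ} : Set ↥(unitaryGroupOfForm (starRingEnd ℂ) (Matrix.of fun i j : Fin 2 => if i.val + j.val + 1 = 2 then (1 : ℂ) else 0))))) [IsFiniteMeasureOnCompacts ρ] :
    ρ {t | ‖(((((t : ↥(Subgroup.centralizer ({γ} : Set ↥(unitaryGroupOfForm (starRingEnd ℂ) (Matrix.of fun i j : Fin 2 => if i.val + j.val + 1 = 2 then (1 : ℂ) else 0))))) : ↥(unitaryGroupOfForm (starRingEnd ℂ) (Matrix.of fun i j : Fin 2 => if i.val + j.val + 1 = 2 then (1 : ℂ) else 0))) : ↥(unitaryGroupOfForm (starRingEnd ℂ) (Matrix.of fun i j : Fin 2 => if i.val + j.val + 1 = 2 then (1 : ℂ) else 0))) : GL (Fin 2) ℂ) : Matrix (Fin 2) (Fin 2) ℂ) 1 1‖ ^ 2 ∈ Icc 1 2} < ⊤ :=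
  (isCompact_chi_Icc hγ hz₀ hab).measure_lt_top

omit [BorelSpace ↥(unitaryGroupOfForm (starRingEnd ℂ) (Matrix.of fun i j : Fin 2 => if i.val + j.val + 1 = 2 then (1 : ℂ) else 0))] in
/-- The `χ`-shell `{t ∈ G_γ ∣ |t₁₁|² ∈ [1, 2]}` has POSITIVE mass for every measure positive on open sets (it contains the open non-empty shell `(1, 2)`, e.g. the real
element `d_τ`, `τ² = 3∕2`). [cite: BeuzartPlessis2020Asterisque, §1.8 p. 39; §1.2 (1.2.2), (1.2.4) p. 21] -/
theorem measure_chi_Icc_ne_zero (hγ : (((γ : ↥(unitaryGroupOfForm (starRingEnd ℂ) (Matrix.of fun i j : Fin 2 => if i.val + j.val + 1 = 2 then (1 : ℂ) else 0))) : GL (Fin 2) ℂ) : Matrix (Fin 2) (Fin 2) ℂ) = !![z₀ * a, 0; 0, z₀ * b])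
    (ρ : Measure ↥(Subgroup.centralizer ({γ} : Set ↥(unitaryGroupOfForm (starRingEnd ℂ) (Matrix.of fun i j : Fin 2 => if i.val + j.val + 1 = 2 then (1 : ℂ) else 0))))) [ρ.IsOpenPosMeasure] :
    ρ {t | ‖(((((t : ↥(Subgroup.centralizer ({γ} : Set ↥(unitaryGroupOfForm (starRingEnd ℂ) (Matrix.of fun i j : Fin 2 => if i.val + j.val + 1 = 2 then (1 : ℂ) else 0))))) : ↥(unitaryGroupOfForm (starRingEnd ℂ) (Matrix.of fun i j : Fin 2 => if i.val + j.val + 1 = 2 then (1 : ℂ) else 0))) : ↥(unitaryGroupOfForm (starRingEnd ℂ) (Matrix.of fun i j : Fin 2 => if i.val + j.val + 1 = 2 then (1 : ℂ) else 0))) : GL (Fin 2) ℂ) : Matrix (Fin 2) (Fin 2) ℂ) 1 1‖ ^ 2 ∈ Icc 1 2} ≠ 0 := by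
  have hopen : IsOpen {t : ↥(Subgroup.centralizer ({γ} : Set ↥(unitaryGroupOfForm (starRingEnd ℂ) (Matrix.of fun i j : Fin 2 => if i.val + j.val + 1 = 2 then (1 : ℂ) else 0)))) | ‖(((((t : ↥(Subgroup.centralizer ({γ} : Set ↥(unitaryGroupOfForm (starRingEnd ℂ) (Matrix.of fun i j : Fin 2 => if i.val + j.val + 1 = 2 then (1 : ℂ) else 0))))) : ↥(unitaryGroupOfForm (starRingEnd ℂ) (Matrix.of fun i j : Fin 2 => if i.val + j.val + 1 = 2 then (1 : ℂ) else 0))) : ↥(unitaryGroupOfForm (starRingEnd ℂ) (Matrix.of fun i j : Fin 2 => if i.val + j.val + 1 = 2 then (1 : ℂ) else 0))) : GL (Fin 2) ℂ) : Matrix (Fin 2) (Fin 2) ℂ) 1 1‖ ^ 2 ∈ Ioo 1 2} :=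
    isOpen_Ioo.preimage (continuous_normSq_apply_one_one_centralizer γ)
  have hτ : Real.sqrt (3 / 2) ≠ 0 := (Real.sqrt_pos.2 (by norm_num)).ne'
  have hne : ({t : ↥(Subgroup.centralizer ({γ} : Set ↥(unitaryGroupOfForm (starRingEnd ℂ) (Matrix.of fun i j : Fin 2 => if i.val + j.val + 1 = 2 then (1 : ℂ) else 0)))) | ‖(((((t : ↥(Subgroup.centralizer ({γ} : Set ↥(unitaryGroupOfForm (starRingEnd ℂ) (Matrix.of fun i j : Fin 2 => if i.val + j.val + 1 = 2 then (1 : ℂ) else 0))))) : ↥(unitaryGroupOfForm (starRingEnd ℂ) (Matrix.of fun i j : Fin 2 => if i.val + j.val + 1 = 2 then (1 : ℂ) else 0))) : ↥(unitaryGroupOfForm (starRingEnd ℂ) (Matrix.of fun i j : Fin 2 => if i.val + j.val + 1 = 2 then (1 : ℂ) else 0))) : GL (Fin 2) ℂ) : Matrix (Fin 2) (Fin 2) ℂ) 1 1‖ ^ 2 ∈ Ioo 1 2}).Nonempty := by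
    refine ⟨⟨archPlaneLiftUnitary ((1 : Circle), !![(Real.sqrt (3 / 2))⁻¹, 0; 0, Real.sqrt (3 / 2)]), lift_diag_mem_centralizer hγ 1 hτ⟩, ?_⟩
    simp only [Set.mem_setOf_eq]
    rw [coe_lift_diag 1 hτ]
    have h32 : ‖((Real.sqrt (3 / 2) : ℝ) : ℂ)‖ ^ 2 = 3 / 2 := by
      rw [Complex.norm_real, Real.norm_eq_abs, abs_of_nonneg (Real.sqrt_nonneg _), Real.sq_sqrt (by norm_num)]
    simp only [Matrix.of_apply, Matrix.cons_val', Matrix.cons_val_one, Matrix.cons_val_fin_one, Matrix.empty_val',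
      Circle.coe_one, one_mul, Set.mem_Ioo]
    rw [h32]; norm_num
  intro h0
  have hsub : {t : ↥(Subgroup.centralizer ({γ} : Set ↥(unitaryGroupOfForm (starRingEnd ℂ) (Matrix.of fun i j : Fin 2 => if i.val + j.val + 1 = 2 then (1 : ℂ) else 0)))) | ‖(((((t : ↥(Subgroup.centralizer ({γ} : Set ↥(unitaryGroupOfForm (starRingEnd ℂ) (Matrix.of fun i j : Fin 2 => if i.val + j.val + 1 = 2 then (1 : ℂ) else 0))))) : ↥(unitaryGroupOfForm (starRingEnd ℂ) (Matrix.of fun i j : Fin 2 => if i.val + j.val + 1 = 2 then (1 : ℂ) else 0))) : ↥(unitaryGroupOfForm (starRingEnd ℂ) (Matrix.of fun i j : Fin 2 => if i.val + j.val + 1 = 2 then (1 : ℂ) else 0))) : GL (Fin 2) ℂ) : Matrix (Fin 2) (Fin 2) ℂ) 1 1‖ ^ 2 ∈ Ioo 1 2} ⊆ {t | ‖(((((t : ↥(Subgroup.centralizer ({γ} : Set ↥(unitaryGroupOfForm (starRingEnd ℂ) (Matrix.of fun i j : Fin 2 => if i.val + j.val + 1 = 2 then (1 : ℂ) else 0)))))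 : ↥(unitaryGroupOfForm (starRingEnd ℂ) (Matrix.of fun i j : Fin 2 => if i.val + j.val + 1 = 2 then (1 : ℂ) else 0))) : ↥(unitaryGroupOfForm (starRingEnd ℂ) (Matrix.of fun i j : Fin 2 => if i.val + j.val + 1 = 2 then (1 : ℂ) else 0))) : GL (Fin 2) ℂ) : Matrix (Fin 2) (Fin 2) ℂ) 1 1‖ ^ 2 ∈ Icc 1 2} :=
    fun t ht => ⟨ht.1.le, ht.2.le⟩
  exact (hopen.measure_pos ρ hne).ne' (measure_mono_null hsub h0)

end Torus


end Literature.NumberTheory.Rogawski1990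

end
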